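import Summits.Langlands.Langlands.Theorems.RationalPeriodQuarterProjectionPrelim
import Summits.Langlands.Langlands.Theorems.RationalPeriodQuarterProjectionMoebius

/-!
# `RationalPeriodQuarter` — the projection lemma `PR_ℂ = PR_ℚ ⊗_ℚ ℂ` for Γ-coboundaries (child A, lemma L3)

Support for `RationalPeriodQuarter.HeckeFieldOfCruxes` (stmt-Langlands-10432), seed node `HeckeFieldOfCruxesSplit`,
child A `RationalFormsInjectivity`.  `rpq_projection`: for `ℚ`-independent `e : Fin n → ℂ` and `ρ ∈ PR_ℂ` there are
`ρ_l ∈ PR_ℂ` such that for every `γ ∈ SL₂(ℤ)` and `PR_ℚ` functions `q_l`, the cofinite identity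
`∑ e_l q_l = ρ − ρ|γ` forces `q_l = ρ_l − ρ_l|γ` cofinitely (`|` = the route's inlined weight-1/2 real slash).
Proof: `ρ_l := rpqProjFun (π_l) ρ` for dual functionals `π_l`; the identity holds at all but finitely many RATIONAL
points by pointwise `ℚ`-linearity, then on every one-sided neighbourhood and on both tails by continuity and density
(`rpq_filter_step`, Möbius limits), hence cofinitely (`anCore_cofinite_of_local`).
-/

set_option linter.dupNamespace false

namespace Summit.Langlands.Langlands.Theorems

open scoped BigOperators Topology
open Filter Set Polynomial

/-- THE PROJECTION LEMMA (child A, L3).  For `ℚ`-independent `e : Fin n → ℂ` and `ρ ∈ PR_ℂ` there are `ρ_l ∈ PR_ℂ`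
(the coefficientwise dual-functional projections of `ρ`) such that for every `γ ∈ SL₂(ℤ)` and `PR_ℚ` functions `q_l`,
`∑ e_l q_l = ρ − ρ|γ` cofinitely implies `q_l = ρ_l − ρ_l|γ` cofinitely (`|` the route's inlined `slashHalf`). -/
theorem rpq_projection {n : ℕ} (e : Fin n → ℂ) (he : LinearIndependent ℚ e) (ρ : ℝ → ℂ)
    (hρ : (∃ F : Finset ℚ, (∀ a b : ℚ, a < b → (∀ r ∈ F, r ≤ a ∨ b ≤ r) → ∃ (P : Polynomial ℂ) (Q : Polynomial ℚ), ∀ x : ℝ, (a : ℝ) < x → x < b → Polynomial.aeval (x : ℂ) Q ≠ 0 ∧ ρ x = Polynomial.eval (x : ℂ) P / Polynomial.aeval (x : ℂ) Q) ∧ ∃ B : ℚ, (∃ (P : Polynomial ℂ) (Q : Polynomial ℚ), ∀ x : ℝ, (B : ℝ) < x → Polynomial.aeval (x : ℂ) Q ≠ 0 ∧ ρ x = Polynomial.eval (x : ℂ) P / Polynomial.aeval (x : ℂ) Q) ∧ (∃ (P : Polynomial ℂ) (Q : Polynomial ℚ), ∀ x : ℝ, x < -(B : ℝ) → Polynomial.aeval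 (x : ℂ) Q ≠ 0 ∧ ρ x = Polynomial.eval (x : ℂ) P / Polynomial.aeval (x : ℂ) Q))) :
    ∃ ρc : Fin n → ℝ → ℂ, (∀ l, (∃ F : Finset ℚ, (∀ a b : ℚ, a < b → (∀ r ∈ F, r ≤ a ∨ b ≤ r) → ∃ (P : Polynomial ℂ) (Q : Polynomial ℚ), ∀ x : ℝ, (a : ℝ) < x → x < b → Polynomial.aeval (x : ℂ) Q ≠ 0 ∧ ρc l x = Polynomial.eval (x : ℂ) P / Polynomial.aeval (x : ℂ) Q) ∧ ∃ B : ℚ, (∃ (P : Polynomial ℂ) (Q : Polynomial ℚ), ∀ x : ℝ, (B : ℝ) < x → Polynomial.aeval (x : ℂ) Q ≠ 0 ∧ ρc l x = Polynomial.eval (x : ℂ) P / Polynomial.aeval (x : ℂ) Q) ∧ (∃ (P : Polynomial ℂ) (Q : Polynomial ℚ), ∀ x : ℝ, x < -(B : ℝ) → Polynomial.aeval (x : ℂ) Q ≠ 0 ∧ ρc l x = Polynomial.eval (x : ℂ) P / Polynomial.aeval (x : ℂ) Q))) ∧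
      ∀ (γ : Matrix.SpecialLinearGroup (Fin 2) ℤ) (q : Fin n → ℝ → ℂ), (∀ l, (∃ F : Finset ℚ, (∀ a b : ℚ, a < b → (∀ r ∈ F, r ≤ a ∨ b ≤ r) → ∃ P Q : Polynomial ℚ, ∀ x : ℝ, (a : ℝ) < x → x < b → Polynomial.aeval (x : ℂ) Q ≠ 0 ∧ q l x = Polynomial.aeval (x : ℂ) P / Polynomial.aeval (x : ℂ) Q) ∧ ∃ B : ℚ, (∃ P Q : Polynomial ℚ, ∀ x : ℝ, (B : ℝ) < x → Polynomial.aeval (x : ℂ) Q ≠ 0 ∧ q l x = Polynomial.aeval (x : ℂ) P / Polynomial.aeval (x : ℂ) Q) ∧ (∃ P Q : Polynomial ℚ, ∀ x : ℝ, x < -(B : ℝ) → Polynomial.aeval (x : ℂ) Q ≠ 0 ∧ q l x = Polynomial.aeval (x : ℂ) P / Polynomial.aeval (x : ℂ) Q))) →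
        (∀ᶠ (t : ℝ) in Filter.cofinite, ∑ l, e l * q l t = ρ t - ((|((γ : Matrix (Fin 2) (Fin 2) ℤ) 1 0 : ℝ) * t + ((γ : Matrix (Fin 2) (Fin 2) ℤ) 1 1 : ℝ)|⁻¹ : ℝ) : ℂ) * ρ ((((γ : Matrix (Fin 2) (Fin 2) ℤ) 0 0 : ℝ) * t + ((γ : Matrix (Fin 2) (Fin 2) ℤ) 0 1 : ℝ)) / (((γ : Matrix (Fin 2) (Fin 2) ℤ) 1 0 : ℝ) * t + ((γ : Matrix (Fin 2) (Fin 2) ℤ) 1 1 : ℝ)))) →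
        ∀ l, ∀ᶠ (t : ℝ) in Filter.cofinite, q l t = ρc l t - ((|((γ : Matrix (Fin 2) (Fin 2) ℤ) 1 0 : ℝ) * t + ((γ : Matrix (Fin 2) (Fin 2) ℤ) 1 1 : ℝ)|⁻¹ : ℝ) : ℂ) * (ρc l) ((((γ : Matrix (Fin 2) (Fin 2) ℤ) 0 0 : ℝ) * t + ((γ : Matrix (Fin 2) (Fin 2) ℤ) 0 1 : ℝ)) / (((γ : Matrix (Fin 2) (Fin 2) ℤ) 1 0 : ℝ) * t + ((γ : Matrix (Fin 2) (Fin 2) ℤ) 1 1 : ℝ))) := by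
  classical
  obtain ⟨π, hπ⟩ := rpq_exists_dual e he
  refine ⟨fun l => rpqProjFun (π l) ρ, fun l => rpqProjFun_isPRC (π l) ρ hρ, ?_⟩
  intro γ q hq hid l
  -- entries and determinant
  set a : ℝ := ((γ : Matrix (Fin 2) (Fin 2) ℤ) 0 0 : ℝ) with ha
  set b : ℝ := ((γ : Matrix (Fin 2) (Fin 2) ℤ) 0 1 : ℝ) with hb
  set c : ℝ := ((γ : Matrix (Fin 2) (Fin 2) ℤ) 1 0 : ℝ) with hc
  set d : ℝ := ((γ : Matrix (Fin 2) (Fin 2) ℤ) 1 1 : ℝ) with hd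
  have hdetZ : ((γ : Matrix (Fin 2) (Fin 2) ℤ) 0 0 : ℤ) * (γ : Matrix (Fin 2) (Fin 2) ℤ) 1 1 - (γ : Matrix (Fin 2) (Fin 2) ℤ) 0 1 * (γ : Matrix (Fin 2) (Fin 2) ℤ) 1 0 = 1 := by
    have := Matrix.SpecialLinearGroup.det_coe γ
    rwa [Matrix.det_fin_two] at this
  have hdet : a * d - b * c = 1 := by
    rw [ha, hb, hc, hd]; exact_mod_cast hdetZ
  have hcd0 : c ≠ 0 ∨ d ≠ 0 := by
    by_contra h
    push Not at h
    rw [h.1, h.2] at hdet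
    norm_num at hdet
  -- data
  set ρπ : ℝ → ℂ := rpqProjFun (π l) ρ with hρπ
  obtain ⟨Fρ, hFρ, Bρ, hρR, hρL⟩ := hρ
  obtain ⟨F₁, hF₁, B₁, ⟨P₁R, Q₁R, h₁R⟩, ⟨P₁L, Q₁L, h₁L⟩⟩ := rpqProjFun_isPRC (π l) ρ ⟨Fρ, hFρ, Bρ, hρR, hρL⟩
  obtain ⟨Fq, hFq, Bq, ⟨AR, BR, hqR⟩, ⟨AL, BL, hqL⟩⟩ := hq l
  have hFq' : ∀ l', ∃ F : Finset ℚ, ∀ a b : ℚ, a < b → (∀ r ∈ F, r ≤ a ∨ b ≤ r) → ∃ P Q : Polynomial ℚ,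
      ∀ x : ℝ, (a : ℝ) < x → x < b → Polynomial.aeval (x : ℂ) Q ≠ 0 ∧
        q l' x = Polynomial.aeval (x : ℂ) P / Polynomial.aeval (x : ℂ) Q := fun l' => by
    obtain ⟨F, hF, -⟩ := hq l'
    exact ⟨F, hF⟩
  choose Fq' hFq'spec using hFq'
  -- finiteness of the exceptional set and density of the good rationals
  have hfin_cd : Set.Finite {t : ℝ | c * t + d = 0} := rpq_finite_affine c d hcd0
  have hcdcof : ∀ᶠ (t : ℝ) in Filter.cofinite, c * t + d ≠ 0 := by
    simp only [Filter.eventually_cofinite, not_not]; exact hfin_cd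
  set castF : Set ℝ := (fun r : ℚ => (r : ℝ)) '' (Fρ : Set ℚ) with hcastF
  have hcastF_fin : castF.Finite := Fρ.finite_toSet.image _
  set E : Set ℝ := castF ∪ ((fun t : ℝ => (a * t + b) / (c * t + d)) ⁻¹' castF) ∪ {t : ℝ | c * t + d = 0} ∪
    (⋃ l', (fun r : ℚ => (r : ℝ)) '' (Fq' l' : Set ℚ)) ∪
    {t : ℝ | ¬ (∑ l, e l * q l t = ρ t - ((|((γ : Matrix (Fin 2) (Fin 2) ℤ) 1 0 : ℝ) * t + ((γ : Matrix (Fin 2) (Fin 2) ℤ) 1 1 : ℝ)|⁻¹ : ℝ) : ℂ) * ρ ((((γ : Matrix (Fin 2) (Fin 2) ℤ) 0 0 : ℝ) * t + ((γ : Matrix (Fin 2) (Fin 2) ℤ) 0 1 : ℝ)) / (((γ : Matrix (Fin 2) (Fin 2) ℤ) 1 0 : ℝ) * t + ((γ : Matrix (Fin 2) (Fin 2) ℤ) 1 1 : ℝ))))} with hE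
  have hEfin : E.Finite := by
    refine (((hcastF_fin.union ?_).union hfin_cd).union ?_).union ?_
    · exact hcastF_fin.preimage' fun r _ => rpq_finite_moebius_fibre a b c d hdet r
    · exact Set.finite_iUnion fun l' => (Fq' l').finite_toSet.image _
    · exact Filter.eventually_cofinite.1 hid
  set D : Set ℝ := Set.range (fun r : ℚ => (r : ℝ)) \ E with hDdef
  have hD : Dense D := (Rat.denseRange_cast (𝕜 := ℝ)).sdiff_finite hEfin
  -- the identity at the good rational points
  have hidD : ∀ t ∈ D, q l t = ρπ t - ((|c * t + d|⁻¹ : ℝ) : ℂ) * ρπ ((a * t + b) / (c * t + d)) := by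
    rintro t ⟨⟨t₀, rfl⟩, htE⟩
    have hnot : ∀ S : Set ℝ, S ⊆ E → (t₀ : ℝ) ∉ S := fun S hS h => htE (hS h)
    have h_i : t₀ ∉ Fρ := fun h => hnot castF (by intro x hx; simp only [hE, Set.mem_union]; tauto) ⟨t₀, h, rfl⟩
    have h_iii : c * t₀ + d ≠ 0 := fun h => hnot {t : ℝ | c * t + d = 0}
      (by intro x hx; simp only [hE, Set.mem_union]; tauto) h
    have h_iv : ∀ l', t₀ ∉ Fq' l' := fun l' h => hnot (⋃ l', (fun r : ℚ => (r : ℝ)) '' (Fq' l' : Set ℚ))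
      (by intro x hx; simp only [hE, Set.mem_union]; tauto) (Set.mem_iUnion.2 ⟨l', ⟨t₀, h, rfl⟩⟩)
    have h_v : ∑ l', e l' * q l' t₀ = ρ t₀ - ((|((γ : Matrix (Fin 2) (Fin 2) ℤ) 1 0 : ℝ) * (t₀ : ℝ) + ((γ : Matrix (Fin 2) (Fin 2) ℤ) 1 1 : ℝ)|⁻¹ : ℝ) : ℂ) * ρ ((((γ : Matrix (Fin 2) (Fin 2) ℤ) 0 0 : ℝ) * (t₀ : ℝ) + ((γ : Matrix (Fin 2) (Fin 2) ℤ) 0 1 : ℝ)) / (((γ : Matrix (Fin 2) (Fin 2) ℤ) 1 0 : ℝ) * (t₀ : ℝ) + ((γ : Matrix (Fin 2) (Fin 2) ℤ) 1 1 : ℝ))) := by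
      by_contra h
      exact hnot {t : ℝ | ¬ (∑ l, e l * q l t = ρ t - ((|((γ : Matrix (Fin 2) (Fin 2) ℤ) 1 0 : ℝ) * t + ((γ : Matrix (Fin 2) (Fin 2) ℤ) 1 1 : ℝ)|⁻¹ : ℝ) : ℂ) * ρ ((((γ : Matrix (Fin 2) (Fin 2) ℤ) 0 0 : ℝ) * t + ((γ : Matrix (Fin 2) (Fin 2) ℤ) 0 1 : ℝ)) / (((γ : Matrix (Fin 2) (Fin 2) ℤ) 1 0 : ℝ) * t + ((γ : Matrix (Fin 2) (Fin 2) ℤ) 1 1 : ℝ))))}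
        (by intro x hx; simp only [hE, Set.mem_union]; tauto) h
    -- the image point is rational
    set m₀ : ℚ := (((γ : Matrix (Fin 2) (Fin 2) ℤ) 0 0 : ℚ) * t₀ + ((γ : Matrix (Fin 2) (Fin 2) ℤ) 0 1 : ℚ)) / (((γ : Matrix (Fin 2) (Fin 2) ℤ) 1 0 : ℚ) * t₀ + ((γ : Matrix (Fin 2) (Fin 2) ℤ) 1 1 : ℚ)) with hm₀
    have hm : (a * t₀ + b) / (c * t₀ + d) = (m₀ : ℝ) := by
      rw [hm₀, ha, hb, hc, hd]; push_cast; ring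
    have h_ii : m₀ ∉ Fρ := fun h => hnot ((fun t : ℝ => (a * t + b) / (c * t + d)) ⁻¹' castF)
      (by intro x hx; simp only [hE, Set.mem_union]; tauto) (by
        show (a * t₀ + b) / (c * t₀ + d) ∈ castF
        rw [hm]; exact ⟨m₀, h, rfl⟩)
    -- the slash factor is rational
    set s₀ : ℚ := |((γ : Matrix (Fin 2) (Fin 2) ℤ) 1 0 : ℚ) * t₀ + ((γ : Matrix (Fin 2) (Fin 2) ℤ) 1 1 : ℚ)|⁻¹ with hs₀
    have hsR : (|c * t₀ + d|⁻¹ : ℝ) = ((s₀ : ℚ) : ℝ) := by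
      rw [hs₀, hc, hd]; push_cast; ring_nf
    have hs : ((|c * t₀ + d|⁻¹ : ℝ) : ℂ) = ((s₀ : ℚ) : ℂ) := by
      rw [hsR, Complex.ofReal_ratCast]
    -- values
    have hval : ∀ l', ∃ r : ℚ, q l' (t₀ : ℝ) = (r : ℂ) := fun l' =>
      rpq_prq_ratCast_value (q l') (Fq' l') (hFq'spec l') t₀ (h_iv l')
    choose r hr using hval
    have hγa : a = ((((γ : Matrix (Fin 2) (Fin 2) ℤ) 0 0 : ℤ) : ℚ) : ℝ) := by rw [ha]; push_cast; rfl
    -- apply the functional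
    have hsum : ∑ l', e l' * q l' t₀ = ∑ l', e l' * (r l' : ℂ) := Finset.sum_congr rfl fun l' _ => by rw [hr l']
    have hidQ : ((π l (∑ l', e l' * (r l' : ℂ)) : ℚ) : ℂ) =
        ((π l (ρ t₀ - ((s₀ : ℚ) : ℂ) * ρ (m₀ : ℝ)) : ℚ) : ℂ) := by
      rw [← hsum, h_v, hs, hm]
    rw [rpq_dual_combination e π hπ r l, map_sub] at hidQ
    have hsm : π l (((s₀ : ℚ) : ℂ) * ρ (m₀ : ℝ)) = s₀ * π l (ρ (m₀ : ℝ)) := by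
      rw [mul_comm, rpq_pi_mul_ratCast]
    rw [hsm, Rat.cast_sub, Rat.cast_mul, rpqProjFun_ratCast (π l) ρ Fρ hFρ t₀ h_i,
      rpqProjFun_ratCast (π l) ρ Fρ hFρ m₀ h_ii] at hidQ
    rw [hr l, hidQ, hs, hm]
  -- conversions of the tail data to `eval` form
  have hconv : ∀ (φ : ℝ → ℂ) (P : ℂ[X]) (Q : ℚ[X]) (x : ℝ),
      (Polynomial.aeval (x : ℂ) Q ≠ 0 ∧ φ x = P.eval (x : ℂ) / Polynomial.aeval (x : ℂ) Q) →
      ((Q.map (algebraMap ℚ ℂ)).eval (x : ℂ) ≠ 0 ∧ φ x = P.eval (x : ℂ) / (Q.map (algebraMap ℚ ℂ)).eval (x : ℂ)) := by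
    intro φ P Q x h; rwa [rpq_aeval_eq_eval_map] at h
  have hconvQ : ∀ (φ : ℝ → ℂ) (P Q : ℚ[X]) (x : ℝ),
      (Polynomial.aeval (x : ℂ) Q ≠ 0 ∧ φ x = Polynomial.aeval (x : ℂ) P / Polynomial.aeval (x : ℂ) Q) →
      ((Q.map (algebraMap ℚ ℂ)).eval (x : ℂ) ≠ 0 ∧
        φ x = (P.map (algebraMap ℚ ℂ)).eval (x : ℂ) / (Q.map (algebraMap ℚ ℂ)).eval (x : ℂ)) := by
    intro φ P Q x h; rwa [rpq_aeval_eq_eval_map, rpq_aeval_eq_eval_map] at h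
  -- k-data and ρπ-data in the four filters
  have hk_top : ∀ᶠ (t : ℝ) in atTop, (BR.map (algebraMap ℚ ℂ)).eval (t : ℂ) ≠ 0 ∧
      q l t = (AR.map (algebraMap ℚ ℂ)).eval (t : ℂ) / (BR.map (algebraMap ℚ ℂ)).eval (t : ℂ) :=
    (eventually_gt_atTop (Bq : ℝ)).mono fun t ht => hconvQ _ _ _ _ (hqR t ht)
  have hk_bot : ∀ᶠ (t : ℝ) in atBot, (BL.map (algebraMap ℚ ℂ)).eval (t : ℂ) ≠ 0 ∧
      q l t = (AL.map (algebraMap ℚ ℂ)).eval (t : ℂ) / (BL.map (algebraMap ℚ ℂ)).eval (t : ℂ) :=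
    (eventually_lt_atBot (-(Bq : ℝ))).mono fun t ht => hconvQ _ _ _ _ (hqL t ht)
  have h1_top : ∀ᶠ (t : ℝ) in atTop, (Q₁R.map (algebraMap ℚ ℂ)).eval (t : ℂ) ≠ 0 ∧
      ρπ t = P₁R.eval (t : ℂ) / (Q₁R.map (algebraMap ℚ ℂ)).eval (t : ℂ) :=
    (eventually_gt_atTop (B₁ : ℝ)).mono fun t ht => hconv _ _ _ _ (h₁R t ht)
  have h1_bot : ∀ᶠ (t : ℝ) in atBot, (Q₁L.map (algebraMap ℚ ℂ)).eval (t : ℂ) ≠ 0 ∧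
      ρπ t = P₁L.eval (t : ℂ) / (Q₁L.map (algebraMap ℚ ℂ)).eval (t : ℂ) :=
    (eventually_lt_atBot (-(B₁ : ℝ))).mono fun t ht => hconv _ _ _ _ (h₁L t ht)
  -- the local statement at every point
  have hloc : ∀ x : ℝ, ∀ᶠ (t : ℝ) in 𝓝[≠] x,
      q l t = ρπ t - ((|c * t + d|⁻¹ : ℝ) : ℂ) * ρπ ((a * t + b) / (c * t + d)) := by
    intro x
    obtain ⟨Am, Bm, Ap, Bp, hkL, hkR⟩ := tameDecomp_prc_local (q l) Fq (rpq_prq_clause (q l) Fq hFq) x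
    obtain ⟨P1m, Q1m, P1p, Q1p, h1L', h1R'⟩ := tameDecomp_prc_local ρπ F₁ hF₁ x
    have hcdL : ∀ᶠ (t : ℝ) in 𝓝[<] x, c * t + d ≠ 0 :=
      (tameDecomp_eventually_nhdsNE_of_cofinite hcdcof x).filter_mono (nhdsLT_le_nhdsNE x)
    have hcdR : ∀ᶠ (t : ℝ) in 𝓝[>] x, c * t + d ≠ 0 :=
      (tameDecomp_eventually_nhdsNE_of_cofinite hcdcof x).filter_mono (nhdsGT_le_nhdsNE x)
    rw [← nhdsLT_sup_nhdsGT, Filter.eventually_sup]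
    by_cases hx : c * x + d ≠ 0
    · obtain ⟨P2m, Q2m, P2p, Q2p, h2L', h2R'⟩ :=
        tameDecomp_prc_local ρπ F₁ hF₁ ((a * x + b) / (c * x + d))
      exact ⟨rpq_filter_step _ (rpq_gen_nhdsLT x) D hD (q l) ρπ a b c d Am Bm P1m Q1m P2m Q2m hkL h1L' hcdL
          ((rpq_moebius_tendsto_nhdsLT a b c d hdet x hx).eventually h2L') hidD,
        rpq_filter_step _ (rpq_gen_nhdsGT x) D hD (q l) ρπ a b c d Ap Bp P1p Q1p P2p Q2p hkR h1R' hcdR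
          ((rpq_moebius_tendsto_nhdsGT a b c d hdet x hx).eventually h2R') hidD⟩
    · push Not at hx
      have hc0 : c ≠ 0 := by
        intro h0; rw [h0, zero_mul, zero_add] at hx
        rcases hcd0 with h | h
        · exact h h0
        · exact h hx
      exact ⟨rpq_filter_step _ (rpq_gen_nhdsLT x) D hD (q l) ρπ a b c d Am Bm P1m Q1m P₁R
            (Q₁R.map (algebraMap ℚ ℂ)) hkL h1L' hcdL
            ((rpq_moebius_tendsto_pole_LT a b c d hdet hc0 x hx).eventually h1_top) hidD,
        rpq_filter_step _ (rpq_gen_nhdsGT x) D hD (q l) ρπ a b c d Ap Bp P1p Q1p P₁L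
            (Q₁L.map (algebraMap ℚ ℂ)) hkR h1R' hcdR
            ((rpq_moebius_tendsto_pole_GT a b c d hdet hc0 x hx).eventually h1_bot) hidD⟩
  -- the two tails
  have htop : ∀ᶠ (t : ℝ) in atTop,
      q l t = ρπ t - ((|c * t + d|⁻¹ : ℝ) : ℂ) * ρπ ((a * t + b) / (c * t + d)) := by
    by_cases hc0 : c ≠ 0
    · obtain ⟨P2m, Q2m, P2p, Q2p, h2L', h2R'⟩ := tameDecomp_prc_local ρπ F₁ hF₁ (a / c)
      exact rpq_filter_step _ rpq_gen_atTop D hD (q l) ρπ a b c d _ _ _ _ P2m Q2m hk_top h1_top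
        (hcdcof.filter_mono atTop_le_cofinite)
        ((rpq_moebius_tendsto_atTop a b c d hdet hc0).eventually h2L') hidD
    · push Not at hc0
      have hγc : ((γ : Matrix (Fin 2) (Fin 2) ℤ) 1 0 : ℤ) = 0 := by
        have : (((γ : Matrix (Fin 2) (Fin 2) ℤ) 1 0 : ℤ) : ℝ) = 0 := by rw [← hc]; exact hc0
        exact_mod_cast this
      have hadZ : ((γ : Matrix (Fin 2) (Fin 2) ℤ) 0 0 : ℤ) * (γ : Matrix (Fin 2) (Fin 2) ℤ) 1 1 = 1 := by
        have := hdetZ; rw [hγc, mul_zero, sub_zero] at this; exact this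
      have had : (a = 1 ∧ d = 1) ∨ (a = -1 ∧ d = -1) := by
        rcases Int.eq_one_or_neg_one_of_mul_eq_one' hadZ with ⟨h1, h2⟩ | ⟨h1, h2⟩
        · left; rw [ha, hd, h1, h2]; simp
        · right; rw [ha, hd, h1, h2]; simp
      exact rpq_filter_step _ rpq_gen_atTop D hD (q l) ρπ a b c d _ _ _ _ P₁R (Q₁R.map (algebraMap ℚ ℂ))
        hk_top h1_top (hcdcof.filter_mono atTop_le_cofinite)
        ((rpq_moebius_tendsto_translation a b c d hc0 had).1.eventually h1_top) hidD
  have hbot : ∀ᶠ (t : ℝ) in atBot,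
      q l t = ρπ t - ((|c * t + d|⁻¹ : ℝ) : ℂ) * ρπ ((a * t + b) / (c * t + d)) := by
    by_cases hc0 : c ≠ 0
    · obtain ⟨P2m, Q2m, P2p, Q2p, h2L', h2R'⟩ := tameDecomp_prc_local ρπ F₁ hF₁ (a / c)
      exact rpq_filter_step _ rpq_gen_atBot D hD (q l) ρπ a b c d _ _ _ _ P2p Q2p hk_bot h1_bot
        (hcdcof.filter_mono atBot_le_cofinite)
        ((rpq_moebius_tendsto_atBot a b c d hdet hc0).eventually h2R') hidD
    · push Not at hc0
      have hγc : ((γ : Matrix (Fin 2) (Fin 2) ℤ) 1 0 : ℤ) = 0 := by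
        have : (((γ : Matrix (Fin 2) (Fin 2) ℤ) 1 0 : ℤ) : ℝ) = 0 := by rw [← hc]; exact hc0
        exact_mod_cast this
      have hadZ : ((γ : Matrix (Fin 2) (Fin 2) ℤ) 0 0 : ℤ) * (γ : Matrix (Fin 2) (Fin 2) ℤ) 1 1 = 1 := by
        have := hdetZ; rw [hγc, mul_zero, sub_zero] at this; exact this
      have had : (a = 1 ∧ d = 1) ∨ (a = -1 ∧ d = -1) := by
        rcases Int.eq_one_or_neg_one_of_mul_eq_one' hadZ with ⟨h1, h2⟩ | ⟨h1, h2⟩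
        · left; rw [ha, hd, h1, h2]; simp
        · right; rw [ha, hd, h1, h2]; simp
      exact rpq_filter_step _ rpq_gen_atBot D hD (q l) ρπ a b c d _ _ _ _ P₁L (Q₁L.map (algebraMap ℚ ℂ))
        hk_bot h1_bot (hcdcof.filter_mono atBot_le_cofinite)
        ((rpq_moebius_tendsto_translation a b c d hc0 had).2.eventually h1_bot) hidD
  -- from local + tails to cofinite
  obtain ⟨R₁, hR₁⟩ := mem_atTop_sets.1 htop
  obtain ⟨R₂, hR₂⟩ := mem_atBot_sets.1 hbot
  refine anCore_cofinite_of_local (q l)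
    (fun t => ρπ t - ((|c * t + d|⁻¹ : ℝ) : ℂ) * ρπ ((a * t + b) / (c * t + d))) (max R₁ (-R₂)) hloc
    (Filter.Eventually.of_forall fun t ht => ?_)
  rcases ht with h | h
  · exact hR₁ t (le_of_lt (lt_of_le_of_lt (le_max_left _ _) h))
  · exact hR₂ t (by have := le_max_right R₁ (-R₂); linarith)

end Summit.Langlands.Langlands.Theorems
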